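import Mathlib
import HarnessLib
import Literature.Analysis.FluidPDE.ClassicalNSPairingIdentity
import Literature.Analysis.FluidPDE.WholeSpaceIBP
import Summits.NavierStokesRegularity.NavierStokesRegularity.Theorems.QuarterLogPincerTypeIQuantSubcubicExpFluxSlice

/-!
# Crux `QuarterLogPincer.TypeIQuantSubcubicExp` (stmt-NavierStokesRegularity-24077), line `thin_cascade`:
  the time modulus of the pairings `⟪w(t), θ⟫` of a classical solution near the final slice

Helper file (`--supports stmt-NavierStokesRegularity-24077 --as helper`, lead prover ns-tc-p1 g3) toward
the registered stub `stub_thinObjectExtraction` (S2, skeleton v5), trace block, clause (5) of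
`ThinObject` (the weak trace at the singular time is attained along `t ↑ 0`).

For a classical solution `(w, q)` of Navier–Stokes on `[0, T'] × ℝ³` (`T' ≥ 1`), a compactly supported
`C²` test field `θ` vanishing off the ball `B = B(0, R)` with `‖Dθ‖ ≤ C₁`, `‖Δθ‖ ≤ C₂`, `|div θ| ≤ C₃`,
a local energy bound `∫_B |w(σ)|² ≤ E` on `[T' - 1, T']` and a mean-oscillation pressure budget
`∫_{T'-1}^{T'} ∫_B |q - (q)_B|^{3/2} ≤ D₀`:

* `abs_pairing_sub_le_of_classical` —
  `|⟪w(T'), θ⟫ - ⟪w(t), θ⟫| ≤ (C₁ E + C₂ (|B| + E) + C₃ (D₀ + |B|)) (T' - t)^{1/4}` for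
  `T' - 1 ≤ t < T'`.

The proof is the tree's pairing identity with pressure
(`IsClassicalNSSolutionOn.integral_inner_sub_eq_pressure`, Leray 1934 (17)) plus bookkeeping: the
velocity terms are bounded slice-wise by the local energy, the pressure term by
`|div θ| ∫_B |q - (q)_B|` (`∫ div θ = 0`), and Young's inequality `a ≤ (2ε/3) a^{3/2} + ε⁻²/3` with
`ε = (T' - t)^{1/4}` replaces Hölder in time (so that no time-measurability of the slice
oscillation is needed: everything is an upper Lebesgue integral).

HONEST FRAMING: bookkeeping toward one registered stub of an open crux; nothing about Navier–Stokes
regularity is proved; no summit statement is proved by this file.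
-/

noncomputable section

-- the summit-side namespace `Summit.NavierStokesRegularity.NavierStokesRegularity.…` (single-conjunct summit,
-- D-0017) repeats a component by design; the dupNamespace linter would flag every declaration.
set_option linter.dupNamespace false

namespace Summit.NavierStokesRegularity.NavierStokesRegularity.Theorems.ThinCascade

open MeasureTheory Set Function Metric Filter Topology
open scoped ENNReal NNReal InnerProductSpace RealInnerProductSpace Laplacian ContDiff
open Literature.Analysis Literature.Analysis.FluidPDE

/-- Young's inequality in the form `a ≤ (2/3) ε a^{3/2} + (1/3) ε⁻²` (`a ≥ 0`, `ε > 0`). [folklore] -/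
theorem le_young_threeHalves {a ε : ℝ} (ha : 0 ≤ a) (hε : 0 < ε) :
    a ≤ 2 / 3 * (ε * a ^ (3 / 2 : ℝ)) + 1 / 3 * (ε ^ 2)⁻¹ := by
  have h := Real.geom_mean_le_arith_mean2_weighted (w₁ := 2 / 3) (w₂ := 1 / 3)
    (p₁ := ε * a ^ (3 / 2 : ℝ)) (p₂ := (ε ^ 2)⁻¹) (by norm_num) (by norm_num) (by positivity)
    (by positivity) (by norm_num)
  have hl : (ε * a ^ (3 / 2 : ℝ)) ^ (2 / 3 : ℝ) * ((ε ^ 2)⁻¹) ^ (1 / 3 : ℝ) = a := by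
    rw [Real.mul_rpow hε.le (by positivity), ← Real.rpow_mul ha, Real.inv_rpow (by positivity),
      ← Real.rpow_natCast ε 2, ← Real.rpow_mul hε.le]
    have h1 : (3 / 2 : ℝ) * (2 / 3) = 1 := by norm_num
    have h2 : ((2 : ℕ) : ℝ) * (1 / 3) = 2 / 3 := by norm_num
    rw [h1, h2, Real.rpow_one]
    have hε' : ε ^ (2 / 3 : ℝ) ≠ 0 := (Real.rpow_pos_of_pos hε _).ne'
    field_simp
  rw [hl] at h
  exact h

/-- Young's inequality for the extended norm of a real number:
`‖x‖ₑ ≤ (2ε/3) ‖x‖ₑ^{3/2} + ε⁻²/3`. [folklore] -/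
theorem enorm_le_young_threeHalves (x : ℝ) {ε : ℝ} (hε : 0 < ε) :
    ‖x‖ₑ ≤ ENNReal.ofReal (2 / 3 * ε) * ‖x‖ₑ ^ (3 / 2 : ℝ) +
      ENNReal.ofReal (1 / 3 * (ε ^ 2)⁻¹) := by
  have h := le_young_threeHalves (abs_nonneg x) hε
  rw [Real.enorm_eq_ofReal_abs, ENNReal.ofReal_rpow_of_nonneg (abs_nonneg x) (by norm_num),
    ← ENNReal.ofReal_mul (by positivity), ← ENNReal.ofReal_add (by positivity) (by positivity)]
  exact ENNReal.ofReal_le_ofReal (h.trans_eq (by ring))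

/-- Young under the (upper) integral: `∫_s ‖f‖ ≤ (2ε/3) ∫_s ‖f‖^{3/2} + (ε⁻²/3) |s|`; no measurability
of `f` is needed. [folklore] -/
theorem lintegral_enorm_le_young (f : EuclideanSpace ℝ (Fin 3) → ℝ)
    (s : Set (EuclideanSpace ℝ (Fin 3))) {ε : ℝ} (hε : 0 < ε) :
    ∫⁻ y in s, ‖f y‖ₑ ≤ ENNReal.ofReal (2 / 3 * ε) * (∫⁻ y in s, ‖f y‖ₑ ^ (3 / 2 : ℝ)) +
      ENNReal.ofReal (1 / 3 * (ε ^ 2)⁻¹) * volume s := by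
  calc ∫⁻ y in s, ‖f y‖ₑ
      ≤ ∫⁻ y in s, (ENNReal.ofReal (2 / 3 * ε) * ‖f y‖ₑ ^ (3 / 2 : ℝ) +
          ENNReal.ofReal (1 / 3 * (ε ^ 2)⁻¹)) :=
        lintegral_mono fun y => enorm_le_young_threeHalves (f y) hε
    _ = _ := by
        rw [lintegral_add_right _ measurable_const,
          lintegral_const_mul' _ _ ENNReal.ofReal_ne_top, setLIntegral_const]

/-- A field vanishing off the open ball `B(0, R)` has topological support in the closed ball.
[folklore] -/
theorem tsupport_subset_closedBall_of_ball {θ : EuclideanSpace ℝ (Fin 3) → EuclideanSpace ℝ (Fin 3)} {R : ℝ}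
    (hθR : ∀ y, y ∉ ball (0 : EuclideanSpace ℝ (Fin 3)) R → θ y = 0) :
    tsupport θ ⊆ closedBall 0 R := by
  refine closure_minimal (fun y hy => ?_) isClosed_closedBall
  by_contra h
  exact hy (hθR y fun h' => h (ball_subset_closedBall h'))

/-- Pointwise bound for the velocity part of the pairing integrand:
`|⟪v, Dθ v⟫ + ⟪v, Δθ⟫| ≤ C₁ |v|² + C₂ (1 + |v|²)` on the closed ball, `0` off it. [folklore] -/
theorem enorm_velocityIntegrand_le (w : ℝ → EuclideanSpace ℝ (Fin 3) → EuclideanSpace ℝ (Fin 3))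
    {θ : EuclideanSpace ℝ (Fin 3) → EuclideanSpace ℝ (Fin 3)} {R C₁ C₂ : ℝ}
    (hθR : ∀ y, y ∉ ball (0 : EuclideanSpace ℝ (Fin 3)) R → θ y = 0)
    (hC₁ : ∀ y, ‖fderiv ℝ θ y‖ ≤ C₁) (hC₂ : ∀ y, ‖(Δ θ) y‖ ≤ C₂) (τ : ℝ) (x : EuclideanSpace ℝ (Fin 3)) :
    ‖⟪w τ x, convect (w τ) θ x⟫ + 1 * ⟪w τ x, (Δ θ) x⟫ +
        ⟪(0 : ℝ → EuclideanSpace ℝ (Fin 3) → EuclideanSpace ℝ (Fin 3)) τ x, θ x⟫‖ₑ ≤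
      (closedBall (0 : EuclideanSpace ℝ (Fin 3)) R).indicator
        (fun x => ENNReal.ofReal (C₁ * ‖w τ x‖ ^ 2 + C₂ * (1 + ‖w τ x‖ ^ 2))) x := by
  have hC₁0 : 0 ≤ C₁ := (norm_nonneg _).trans (hC₁ 0)
  have hC₂0 : 0 ≤ C₂ := (norm_nonneg _).trans (hC₂ 0)
  have hts := tsupport_subset_closedBall_of_ball hθR
  by_cases hx : x ∈ closedBall (0 : EuclideanSpace ℝ (Fin 3)) R
  · simp only [indicator_of_mem hx, Pi.zero_apply, inner_zero_left, add_zero, one_mul, convect_apply]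
    rw [Real.enorm_eq_ofReal_abs, ← Real.norm_eq_abs]
    refine ENNReal.ofReal_le_ofReal ((norm_add_le _ _).trans (add_le_add ?_ ?_))
    · calc ‖⟪w τ x, fderiv ℝ θ x (w τ x)⟫‖
          ≤ ‖w τ x‖ * ‖fderiv ℝ θ x (w τ x)‖ :=
            (Real.norm_eq_abs _).trans_le (abs_real_inner_le_norm _ _)
        _ ≤ ‖w τ x‖ * (C₁ * ‖w τ x‖) := by
            refine mul_le_mul_of_nonneg_left ?_ (norm_nonneg _)
            exact ((fderiv ℝ θ x).le_opNorm _).trans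
              (mul_le_mul_of_nonneg_right (hC₁ x) (norm_nonneg _))
        _ = C₁ * ‖w τ x‖ ^ 2 := by ring
    · calc ‖⟪w τ x, (Δ θ) x⟫‖ ≤ ‖w τ x‖ * ‖(Δ θ) x‖ :=
            (Real.norm_eq_abs _).trans_le (abs_real_inner_le_norm _ _)
        _ ≤ ‖w τ x‖ * C₂ := mul_le_mul_of_nonneg_left (hC₂ x) (norm_nonneg _)
        _ ≤ (1 + ‖w τ x‖ ^ 2) * C₂ :=
            mul_le_mul_of_nonneg_right
              (by nlinarith [norm_nonneg (w τ x), sq_nonneg (‖w τ x‖ - 1)]) hC₂0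
        _ = C₂ * (1 + ‖w τ x‖ ^ 2) := by ring
  · have hfd0 : fderiv ℝ θ x = 0 := fderiv_of_notMem_tsupport ℝ fun h => hx (hts h)
    have hΔ0 : (Δ θ) x = 0 := laplacian_eq_zero_of_notMem_tsupport fun h => hx (hts h)
    simp [indicator_of_notMem hx, hfd0, hΔ0]

/-- `ENNReal.ofReal (C₁ a² + C₂ (1 + a²)) = C₁ ‖v‖ₑ² + C₂ (1 + ‖v‖ₑ²)` for `a = |v|`. [folklore] -/
theorem ofReal_velocityMajorant_eq (v : EuclideanSpace ℝ (Fin 3)) {C₁ C₂ : ℝ} (hC₁0 : 0 ≤ C₁) (hC₂0 : 0 ≤ C₂) :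
    ENNReal.ofReal (C₁ * ‖v‖ ^ 2 + C₂ * (1 + ‖v‖ ^ 2)) =
      ENNReal.ofReal C₁ * ‖v‖ₑ ^ 2 + ENNReal.ofReal C₂ * (1 + ‖v‖ₑ ^ 2) := by
  rw [← ofReal_norm v, ← ENNReal.ofReal_pow (norm_nonneg _),
    ENNReal.ofReal_add (by positivity) (by positivity), ENNReal.ofReal_mul hC₁0,
    ENNReal.ofReal_mul hC₂0, ENNReal.ofReal_add zero_le_one (by positivity), ENNReal.ofReal_one]

/-- **Velocity part of the pairing identity, slice-wise.**  With `∫_{B(0,R)} |w(τ)|² ≤ E`: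
`|∫ (⟪w, (w·∇)θ⟫ + ⟪w, Δθ⟫)| ≤ C₁ E + C₂ (|B(0,R)| + E)`. [folklore] -/
theorem enorm_integral_velocity_le {w : ℝ → EuclideanSpace ℝ (Fin 3) → EuclideanSpace ℝ (Fin 3)}
    {θ : EuclideanSpace ℝ (Fin 3) → EuclideanSpace ℝ (Fin 3)} {R C₁ C₂ E : ℝ} {τ : ℝ} (hwc : Continuous (w τ))
    (hθR : ∀ y, y ∉ ball (0 : EuclideanSpace ℝ (Fin 3)) R → θ y = 0)
    (hC₁ : ∀ y, ‖fderiv ℝ θ y‖ ≤ C₁) (hC₂ : ∀ y, ‖(Δ θ) y‖ ≤ C₂) (hE₀ : 0 ≤ E)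
    (hE : ∫⁻ y in ball (0 : EuclideanSpace ℝ (Fin 3)) R, ‖w τ y‖ₑ ^ 2 ≤ ENNReal.ofReal E) :
    ‖∫ x, (⟪w τ x, convect (w τ) θ x⟫ + 1 * ⟪w τ x, (Δ θ) x⟫ +
        ⟪(0 : ℝ → EuclideanSpace ℝ (Fin 3) → EuclideanSpace ℝ (Fin 3)) τ x, θ x⟫)‖ₑ ≤
      ENNReal.ofReal (C₁ * E + C₂ * ((volume (ball (0 : EuclideanSpace ℝ (Fin 3)) R)).toReal + E)) := by
  have hC₁0 : 0 ≤ C₁ := (norm_nonneg _).trans (hC₁ 0)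
  have hC₂0 : 0 ≤ C₂ := (norm_nonneg _).trans (hC₂ 0)
  have hVtop : volume (ball (0 : EuclideanSpace ℝ (Fin 3)) R) ≠ ⊤ := measure_ball_lt_top.ne
  have hm : Measurable fun x => ‖w τ x‖ₑ ^ 2 := hwc.measurable.enorm.pow_const _
  refine (enorm_integral_le_lintegral_enorm _).trans ?_
  refine (lintegral_mono (enorm_velocityIntegrand_le w hθR hC₁ hC₂ τ)).trans ?_
  rw [lintegral_indicator measurableSet_closedBall, setLIntegral_closedBall_eq_ball]
  simp_rw [ofReal_velocityMajorant_eq _ hC₁0 hC₂0]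
  rw [lintegral_add_left (hm.const_mul _), lintegral_const_mul _ hm,
    lintegral_const_mul _ (hm.const_add 1), lintegral_add_left measurable_const,
    setLIntegral_one]
  calc ENNReal.ofReal C₁ * (∫⁻ x in ball (0 : EuclideanSpace ℝ (Fin 3)) R, ‖w τ x‖ₑ ^ 2) +
        ENNReal.ofReal C₂ * (volume (ball (0 : EuclideanSpace ℝ (Fin 3)) R) + ∫⁻ x in ball (0 : EuclideanSpace ℝ (Fin 3)) R, ‖w τ x‖ₑ ^ 2)
      ≤ ENNReal.ofReal C₁ * ENNReal.ofReal E +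
        ENNReal.ofReal C₂ * (volume (ball (0 : EuclideanSpace ℝ (Fin 3)) R) + ENNReal.ofReal E) := by
        gcongr
    _ = ENNReal.ofReal (C₁ * E + C₂ * ((volume (ball (0 : EuclideanSpace ℝ (Fin 3)) R)).toReal + E)) := by
        rw [ENNReal.ofReal_add (by positivity) (by positivity), ENNReal.ofReal_mul hC₁0,
          ENNReal.ofReal_mul hC₂0, ENNReal.ofReal_add ENNReal.toReal_nonneg hE₀,
          ENNReal.ofReal_toReal hVtop]

/-- **Pressure part of the pairing identity, slice-wise.**  For continuous `p` and `ε > 0`: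
`|∫ p div θ| ≤ C₃ ((2ε/3) ∫_{B(0,R)} |p - (p)_B|^{3/2} + (ε⁻²/3) |B(0,R)|)`
(`∫ div θ = 0`, then Young under the integral). [folklore] -/
theorem enorm_integral_pressure_le {p : EuclideanSpace ℝ (Fin 3) → ℝ} (hpc : Continuous p)
    {θ : EuclideanSpace ℝ (Fin 3) → EuclideanSpace ℝ (Fin 3)} {R C₃ ε : ℝ} (hθ : ContDiff ℝ 2 θ)
    (hθR : ∀ y, y ∉ ball (0 : EuclideanSpace ℝ (Fin 3)) R → θ y = 0)
    (hC₃ : ∀ y, ‖VectorCalculus.divergence θ y‖ ≤ C₃) (hε : 0 < ε) :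
    ‖∫ x, p x * VectorCalculus.divergence θ x‖ₑ ≤ ENNReal.ofReal C₃ *
      (ENNReal.ofReal (2 / 3 * ε) *
          (∫⁻ y in ball (0 : EuclideanSpace ℝ (Fin 3)) R, ‖p y - ⨍ z in ball (0 : EuclideanSpace ℝ (Fin 3)) R, p z‖ₑ ^ (3 / 2 : ℝ)) +
        ENNReal.ofReal (1 / 3 * (ε ^ 2)⁻¹) * volume (ball (0 : EuclideanSpace ℝ (Fin 3)) R)) := by
  have hts := tsupport_subset_closedBall_of_ball hθR
  have hθc : HasCompactSupport θ :=
    HasCompactSupport.of_support_subset_isCompact (isCompact_closedBall (0 : EuclideanSpace ℝ (Fin 3)) R)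
      ((subset_tsupport θ).trans hts)
  have hdiv0 : ∀ y, y ∉ closedBall (0 : EuclideanSpace ℝ (Fin 3)) R → VectorCalculus.divergence θ y = 0 :=
    fun y hy => divergence_eq_zero_of_notMem_tsupport fun h => hy (hts h)
  have hdc : Continuous (VectorCalculus.divergence θ) :=
    continuous_divergence (hθ.continuous_fderiv (by norm_num))
  have hdcs : HasCompactSupport (VectorCalculus.divergence θ) :=
    HasCompactSupport.intro (isCompact_closedBall (0 : EuclideanSpace ℝ (Fin 3)) R) hdiv0
  obtain ⟨m, hm⟩ : ∃ m : ℝ, m = ⨍ z in ball (0 : EuclideanSpace ℝ (Fin 3)) R, p z := ⟨_, rfl⟩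
  rw [← hm]
  have hi1 : Integrable (fun x => p x * VectorCalculus.divergence θ x) :=
    (hpc.mul hdc).integrable_of_hasCompactSupport hdcs.mul_left
  have hi2 : Integrable (fun x => m * VectorCalculus.divergence θ x) :=
    (continuous_const.mul hdc).integrable_of_hasCompactSupport hdcs.mul_left
  have e0 : ∫ x, m * VectorCalculus.divergence θ x = 0 := by
    rw [integral_const_mul, integral_divergence_eq_zero (hθ.of_le one_le_two) hθc, mul_zero]
  have e1 : ∫ x, p x * VectorCalculus.divergence θ x =
      ∫ x, (p x - m) * VectorCalculus.divergence θ x := by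
    have : (fun x => (p x - m) * VectorCalculus.divergence θ x) =
        fun x => p x * VectorCalculus.divergence θ x - m * VectorCalculus.divergence θ x :=
      funext fun x => by ring
    rw [this, integral_sub hi1 hi2, e0, sub_zero]
  have hpt : ∀ x, ‖(p x - m) * VectorCalculus.divergence θ x‖ₑ ≤
      (closedBall (0 : EuclideanSpace ℝ (Fin 3)) R).indicator (fun x => ENNReal.ofReal C₃ * ‖p x - m‖ₑ) x := by
    intro x
    by_cases hx : x ∈ closedBall (0 : EuclideanSpace ℝ (Fin 3)) R
    · simp only [indicator_of_mem hx, enorm_mul]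
      rw [mul_comm, Real.enorm_eq_ofReal_abs (VectorCalculus.divergence θ x), ← Real.norm_eq_abs]
      exact mul_le_mul_of_nonneg_right (ENNReal.ofReal_le_ofReal (hC₃ x)) bot_le
    · simp [indicator_of_notMem hx, hdiv0 x hx]
  have hy := lintegral_enorm_le_young (fun y => p y - m) (ball (0 : EuclideanSpace ℝ (Fin 3)) R) hε
  rw [e1]
  refine (enorm_integral_le_lintegral_enorm _).trans ?_
  refine (lintegral_mono hpt).trans ?_
  rw [lintegral_indicator measurableSet_closedBall, setLIntegral_closedBall_eq_ball,
    lintegral_const_mul' _ _ ENNReal.ofReal_ne_top]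
  exact mul_le_mul_of_nonneg_left hy bot_le

/-- **Time modulus of the pairings near the final slice.**  Let `(w, q)` be a classical solution of
Navier–Stokes (`ν = 1`, `f = 0`) on `[0, T'] × ℝ³`, `T' ≥ 1`; `θ` a `C²` field vanishing off
`B = B(0, R)` with `‖Dθ‖ ≤ C₁`, `‖Δθ‖ ≤ C₂`, `|div θ| ≤ C₃`; assume `∫_B |w(σ)|² ≤ E` for
`σ ∈ [T' - 1, T']` and `∫_{[T'-1, T']} ∫_B |q - (q)_B|^{3/2} ≤ D₀`.  Then for `T' - 1 ≤ t < T'`,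
`|⟪w(T'), θ⟫ - ⟪w(t), θ⟫| ≤ (C₁ E + C₂ (|B| + E) + C₃ (D₀ + |B|)) (T' - t)^{1/4}`
(pairing identity with pressure, `∫ div θ = 0`, Young in place of Hölder in time). [folklore] -/
theorem abs_pairing_sub_le_of_classical {T' R E D₀ C₁ C₂ C₃ : ℝ}
    {w : ℝ → EuclideanSpace ℝ (Fin 3) → EuclideanSpace ℝ (Fin 3)}
    {q : ℝ → EuclideanSpace ℝ (Fin 3) → ℝ}
    (hcl : IsClassicalNSSolutionOn (Icc 0 T') 1 0 w q) (hT' : 1 ≤ T')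
    {θ : EuclideanSpace ℝ (Fin 3) → EuclideanSpace ℝ (Fin 3)} (hθ : ContDiff ℝ 2 θ)
    (hθR : ∀ y, y ∉ ball (0 : EuclideanSpace ℝ (Fin 3)) R → θ y = 0)
    (hC₁ : ∀ y, ‖fderiv ℝ θ y‖ ≤ C₁) (hC₂ : ∀ y, ‖(Δ θ) y‖ ≤ C₂)
    (hC₃ : ∀ y, ‖VectorCalculus.divergence θ y‖ ≤ C₃) (hE₀ : 0 ≤ E) (hD₀ : 0 ≤ D₀)
    (hE : ∀ σ ∈ Icc (T' - 1) T',
      ∫⁻ y in ball (0 : EuclideanSpace ℝ (Fin 3)) R, ‖w σ y‖ₑ ^ 2 ≤ ENNReal.ofReal E)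
    (hD : ∫⁻ σ in Icc (T' - 1) T', ∫⁻ y in ball (0 : EuclideanSpace ℝ (Fin 3)) R,
        ‖q σ y - ⨍ z in ball (0 : EuclideanSpace ℝ (Fin 3)) R, q σ z‖ₑ ^ (3 / 2 : ℝ) ≤
        ENNReal.ofReal D₀)
    {t : ℝ} (ht : t ∈ Ico (T' - 1) T') :
    |(∫ y, ⟪w T' y, θ y⟫) - ∫ y, ⟪w t y, θ y⟫| ≤
      (C₁ * E + C₂ * ((volume (ball (0 : EuclideanSpace ℝ (Fin 3)) R)).toReal + E) +
        C₃ * (D₀ + (volume (ball (0 : EuclideanSpace ℝ (Fin 3)) R)).toReal)) *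
        Real.sqrt (Real.sqrt (T' - t)) := by
  -- notation and elementary facts
  obtain ⟨V, hV⟩ : ∃ V : ℝ≥0∞, V = volume (ball (0 : EuclideanSpace ℝ (Fin 3)) R) := ⟨_, rfl⟩
  have hVtop : V ≠ ⊤ := by rw [hV]; exact measure_ball_lt_top.ne
  have hVr0 : 0 ≤ V.toReal := ENNReal.toReal_nonneg
  have hVr : V = ENNReal.ofReal V.toReal := (ENNReal.ofReal_toReal hVtop).symm
  rw [← hV]
  have hδ0 : 0 < T' - t := by linarith [ht.2]
  have hδ1 : T' - t ≤ 1 := by linarith [ht.1]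
  obtain ⟨ε, hεdef⟩ : ∃ ε : ℝ, ε = Real.sqrt (Real.sqrt (T' - t)) := ⟨_, rfl⟩
  rw [← hεdef]
  have hε0 : 0 < ε := by rw [hεdef]; exact Real.sqrt_pos.2 (Real.sqrt_pos.2 hδ0)
  have hε2 : ε ^ 2 = Real.sqrt (T' - t) := by rw [hεdef]; exact Real.sq_sqrt (Real.sqrt_nonneg _)
  have hε4 : (ε ^ 2) ^ 2 = T' - t := by rw [hε2, Real.sq_sqrt hδ0.le]
  have hε1 : ε ≤ 1 := by
    rw [hεdef, Real.sqrt_le_one, Real.sqrt_le_one]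
    exact hδ1
  have hδε : T' - t ≤ ε := by
    have h4 : ε ^ 4 ≤ ε ^ 1 := pow_le_pow_of_le_one hε0.le hε1 (by norm_num)
    calc T' - t = ε ^ 4 := by rw [← hε4]; ring
      _ ≤ ε := by simpa using h4
  have hε2le : ε ^ 2 ≤ ε := by simpa using pow_le_pow_of_le_one hε0.le hε1 one_le_two
  have hεδ : (ε ^ 2)⁻¹ * (T' - t) = ε ^ 2 := by
    rw [← hε4]; field_simp
  have hC₁0 : 0 ≤ C₁ := (norm_nonneg _).trans (hC₁ 0)
  have hC₂0 : 0 ≤ C₂ := (norm_nonneg _).trans (hC₂ 0)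
  have hC₃0 : 0 ≤ C₃ := (norm_nonneg _).trans (hC₃ 0)
  have hθc : HasCompactSupport θ :=
    HasCompactSupport.of_support_subset_isCompact (isCompact_closedBall (0 : EuclideanSpace ℝ (Fin 3)) R)
      ((subset_tsupport θ).trans (tsupport_subset_closedBall_of_ball hθR))
  -- times
  have hT'0 : 0 < T' := by linarith
  have ht0 : 0 ≤ t := by linarith [ht.1]
  have hsub : Ioc t T' ⊆ Icc (T' - 1) T' := fun τ hτ => ⟨ht.1.trans hτ.1.le, hτ.2⟩
  have hsub0 : Icc (T' - 1) T' ⊆ Icc 0 T' := fun τ hτ => ⟨by linarith [hτ.1], hτ.2⟩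
  -- slice bounds for the integrand of the pairing identity
  have hslice : ∀ τ ∈ Ioc t T',
      ‖((∫ x, (⟪w τ x, convect (w τ) θ x⟫ + 1 * ⟪w τ x, (Δ θ) x⟫ +
          ⟪(0 : ℝ → EuclideanSpace ℝ (Fin 3) → EuclideanSpace ℝ (Fin 3)) τ x, θ x⟫)) +
          ∫ x, q τ x * VectorCalculus.divergence θ x)‖ₑ ≤
        ENNReal.ofReal (C₁ * E + C₂ * (V.toReal + E)) + ENNReal.ofReal C₃ *
          (ENNReal.ofReal (2 / 3 * ε) * (∫⁻ y in ball (0 : EuclideanSpace ℝ (Fin 3)) R,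
              ‖q τ y - ⨍ z in ball (0 : EuclideanSpace ℝ (Fin 3)) R, q τ z‖ₑ ^ (3 / 2 : ℝ)) +
            ENNReal.ofReal (1 / 3 * (ε ^ 2)⁻¹) * V) := by
    intro τ hτ
    have hτ1 : τ ∈ Icc (T' - 1) T' := hsub hτ
    have hτS : τ ∈ Icc 0 T' := hsub0 hτ1
    have h1 := enorm_integral_velocity_le (hcl.contDiff_velocity hτS).continuous hθR hC₁ hC₂ hE₀
      (hE τ hτ1)
    have h2 := enorm_integral_pressure_le (hcl.contDiff_pressure hτS).continuous hθ hθR hC₃ hε0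
      (p := q τ)
    rw [← hV] at h1 h2
    exact (enorm_add_le _ _).trans (add_le_add h1 h2)
  -- the pressure budget on the sub-window
  have hPD : ∫⁻ τ in Ioc t T', ∫⁻ y in ball (0 : EuclideanSpace ℝ (Fin 3)) R,
      ‖q τ y - ⨍ z in ball (0 : EuclideanSpace ℝ (Fin 3)) R, q τ z‖ₑ ^ (3 / 2 : ℝ) ≤
      ENNReal.ofReal D₀ := (lintegral_mono_set hsub).trans hD
  -- the real bookkeeping of the final constant
  have hfin : (C₁ * E + C₂ * (V.toReal + E)) * (T' - t) +
      C₃ * (2 / 3 * ε * D₀ + 1 / 3 * (ε ^ 2)⁻¹ * V.toReal * (T' - t)) ≤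
      (C₁ * E + C₂ * (V.toReal + E) + C₃ * (D₀ + V.toReal)) * ε := by
    have i1 : (C₁ * E + C₂ * (V.toReal + E)) * (T' - t) ≤ (C₁ * E + C₂ * (V.toReal + E)) * ε :=
      mul_le_mul_of_nonneg_left hδε (by positivity)
    have i2 : 2 / 3 * ε * D₀ ≤ D₀ * ε := by nlinarith [hD₀, hε0.le]
    have i3 : 1 / 3 * (ε ^ 2)⁻¹ * V.toReal * (T' - t) ≤ V.toReal * ε := by
      rw [show 1 / 3 * (ε ^ 2)⁻¹ * V.toReal * (T' - t) =
          1 / 3 * (V.toReal * ((ε ^ 2)⁻¹ * (T' - t))) by ring, hεδ]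
      nlinarith [hVr0, hε2le]
    have i4 : C₃ * (2 / 3 * ε * D₀ + 1 / 3 * (ε ^ 2)⁻¹ * V.toReal * (T' - t)) ≤
        C₃ * (D₀ * ε + V.toReal * ε) := mul_le_mul_of_nonneg_left (add_le_add i2 i3) hC₃0
    nlinarith [i1, i4]
  have hb0 : 0 ≤ (C₁ * E + C₂ * (V.toReal + E) + C₃ * (D₀ + V.toReal)) * ε := by positivity
  -- the identity and the time integration
  have hid := hcl.integral_inner_sub_eq_pressure hT'0 hθ hθc ht0 ht.2.le le_rfl
  rw [hid, intervalIntegral.integral_of_le ht.2.le]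
  refine (ENNReal.ofReal_le_ofReal_iff hb0).1 ?_
  rw [← Real.enorm_eq_ofReal_abs]
  refine (enorm_integral_le_lintegral_enorm _).trans ?_
  refine (setLIntegral_mono' measurableSet_Ioc hslice).trans ?_
  rw [lintegral_add_left measurable_const, setLIntegral_const,
    lintegral_const_mul' _ _ ENNReal.ofReal_ne_top, lintegral_add_right _ measurable_const,
    lintegral_const_mul' _ _ ENNReal.ofReal_ne_top, setLIntegral_const, Real.volume_Ioc]
  calc ENNReal.ofReal (C₁ * E + C₂ * (V.toReal + E)) * ENNReal.ofReal (T' - t) +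
        ENNReal.ofReal C₃ * (ENNReal.ofReal (2 / 3 * ε) *
            (∫⁻ τ in Ioc t T', ∫⁻ y in ball (0 : EuclideanSpace ℝ (Fin 3)) R,
              ‖q τ y - ⨍ z in ball (0 : EuclideanSpace ℝ (Fin 3)) R, q τ z‖ₑ ^ (3 / 2 : ℝ)) +
          ENNReal.ofReal (1 / 3 * (ε ^ 2)⁻¹) * V * ENNReal.ofReal (T' - t))
      ≤ ENNReal.ofReal (C₁ * E + C₂ * (V.toReal + E)) * ENNReal.ofReal (T' - t) +
        ENNReal.ofReal C₃ * (ENNReal.ofReal (2 / 3 * ε) * ENNReal.ofReal D₀ +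
          ENNReal.ofReal (1 / 3 * (ε ^ 2)⁻¹) * V * ENNReal.ofReal (T' - t)) := by
        gcongr
    _ = ENNReal.ofReal ((C₁ * E + C₂ * (V.toReal + E)) * (T' - t) +
        C₃ * (2 / 3 * ε * D₀ + 1 / 3 * (ε ^ 2)⁻¹ * V.toReal * (T' - t))) := by
        have hA0 : 0 ≤ (C₁ * E + C₂ * (V.toReal + E)) * (T' - t) := by positivity
        have hB0 : 0 ≤ 2 / 3 * ε * D₀ := by positivity
        have hC0 : 0 ≤ 1 / 3 * (ε ^ 2)⁻¹ * V.toReal * (T' - t) := by positivity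
        have hC0' : 0 ≤ 1 / 3 * (ε ^ 2)⁻¹ * V.toReal := by positivity
        have eA : ENNReal.ofReal (C₁ * E + C₂ * (V.toReal + E)) * ENNReal.ofReal (T' - t) =
            ENNReal.ofReal ((C₁ * E + C₂ * (V.toReal + E)) * (T' - t)) :=
          (ENNReal.ofReal_mul (by positivity)).symm
        have eB : ENNReal.ofReal (2 / 3 * ε) * ENNReal.ofReal D₀ = ENNReal.ofReal (2 / 3 * ε * D₀) :=
          (ENNReal.ofReal_mul (by positivity)).symm
        have eC : ENNReal.ofReal (1 / 3 * (ε ^ 2)⁻¹) * V * ENNReal.ofReal (T' - t) =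
            ENNReal.ofReal (1 / 3 * (ε ^ 2)⁻¹ * V.toReal * (T' - t)) := by
          have ha0 : (0 : ℝ) ≤ 1 / 3 * (ε ^ 2)⁻¹ := by positivity
          conv_rhs => rw [ENNReal.ofReal_mul hC0', ENNReal.ofReal_mul ha0, ← hVr]
        rw [eA, eB, eC, ← ENNReal.ofReal_add hB0 hC0, ← ENNReal.ofReal_mul hC₃0,
          ← ENNReal.ofReal_add hA0 (mul_nonneg hC₃0 (add_nonneg hB0 hC0))]
    _ ≤ ENNReal.ofReal ((C₁ * E + C₂ * (V.toReal + E) + C₃ * (D₀ + V.toReal)) * ε) :=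
        ENNReal.ofReal_le_ofReal hfin

end Summit.NavierStokesRegularity.NavierStokesRegularity.Theorems.ThinCascade

end
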